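import Summits.BirchSwinnertonDyer.Rank1Residual.X11a.RankZeroHeightFree
import Summits.BirchSwinnertonDyer.Rank1Residual.X11a.ChainMTT
import Summits.BirchSwinnertonDyer.Rank1Residual.X11a.Cells
import HarnessLib

/-!
# Class X11a: the chain of record with the two height-existence facts DISCHARGED —
# 14 named published facts + the per-pair certificate (cell `b2b-bsdres`, unit `b2b-bsdres-x11a`, gen 18)

HONEST FRAMING (run/shared/lean/b2b/bsd-rank1-residual/, verbatim in every file): the goal of the
cell is to DELETE the COMBINATION-SHAPED residual classes of the Birch–Swinnerton-Dyer formula for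
ALL analytic-rank `≤ 1` elliptic curves over `ℚ` — "full BSD formula for every rank `≤ 1` curve in
class `C`" assembled STRICTLY from published theorems — so that the rank-`≤ 1` remainder becomes
exactly the CONSTRUCTION-SHAPED classes, which are TYPED (missing-input `Prop`s), NOT attempted.
This is not "finishing BSD". Research route; NO CLAIM BEYOND STATED CLASSES. No label change is
made by this file (cell lead / referee).

`X11a/ChainMTT.lean` (gen 16) proves `BSD(E,p)` on X11a ∩ {`p ≥ 5`, `ρ̄_{E,p}` surjective} from 16
named published facts + the per-pair certificate `μ^an(E,p) = 0` (`…_mtt`), on X11a ∩ {`p ≥ 11`}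
from 17 (`…_of_eleven_le`, BDMTV) and on X11a ∩ {`p ≥ 5`, `p ∤ ord_p Δ_min`} from 16
(`…_of_not_dvd`).  Two of those binders, `hHs : SteinWuthrich2013.exists_isSplitMultCanonical` and
`hHn : SteinWuthrich2013.exists_isMultCanonical` (existence of THE Stein–Wuthrich §4.2 `p`-adic
height datum), enter ONLY through the rank-`0` glue
`X2.bsdp_of_mazurMainConjectureAt_of_analyticRank_eq_zero`, where `E(ℚ)` is already known to be
finite — and on a finite `E(ℚ)` THE §4.2 datum is the zero pairing
(`X11a/RankZeroHeightFree.lean`: no admissible point; unique by `IsMultCanonical.unique`).  X11a is a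
rank-`0` class (`ClassX11a W p → W.analyticRank = 0`).  This file re-issues every rank-`0` endpoint
of the X11a chain through the height-free glue
`X2.bsdp_of_mazurMainConjectureAt_of_analyticRank_eq_zero_heightFree`:

* `bsdp_of_mazurMainConjectureAt_heightFree`, `targetLeaf_of_forall_mazurMainConjectureAt_heightFree`,
  `target_of_published_of_missingInputs_heightFree` (the class statement of record, `X11a/Cells.lean`);
* `bsdp_of_invariantsMatchAt_heightFree`, `bsdp_of_muAnZeroAt_of_lambdaPart_heightFree` (the EPW
  endpoints of gens 13–14);
* **`forall_bsdp_of_namedFacts_mtt_heightFree`: X11a ∩ {`p ≥ 5`, surj} — `BSD(E,p)` ⇐ 14 NAMED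
  PUBLISHED FACTS + the certificate** (Hida member; EPW Thm 3.1.1 / Thm 1 / Thm 5.1.3; Wan Thm 4
  rational; Deligne–Serre 6.1; Hida/Wiles 3.26; Kato–Wuthrich A32; Stein–Wuthrich Thm 6.1 ×2; GZK;
  modularity ×2; Greenberg–Stevens), `…_of_eleven_le_heightFree` (15, + BDMTV, no image hypothesis),
  `…_of_not_dvd_heightFree` (14, no image hypothesis when `p ∤ ord_p Δ_min`);
* `X2.bsdp_of_classX2_of_gvPar_of_analyticRank_eq_zero_heightFree` (X2a on the cell's predicates).

Nothing else changes: every remaining binder is an explicit NAMED published fact; the per-pair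
certificate `X11a.MuAnZeroAt` is still required; the informational flags (`Wan15-Thm103-Fujiwara`,
`EPW-canonical-period`, Greenberg-vs-classical Selmer) are unchanged.

References: as in `X11a/ChainNamedFacts.lean`, `X11a/ChainMTT.lean`; Stein–Wuthrich 2013 Thm. 6.1,
§4.2 [SteinWuthrich2013].
-/

noncomputable section

open scoped Classical MatrixGroups ModularForm

open CongruenceSubgroup WeierstrassCurve Literature.NumberTheory.EllipticCurves
  Literature.NumberTheory.EllipticCurves.ModularForms
  Literature.NumberTheory.EllipticCurves.Rank1Residual
  Literature.NumberTheory.EllipticCurves.Rank1Residual.Typed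
  Literature.NumberTheory.EllipticCurves.Wuthrich2014
  Literature.NumberTheory.EllipticCurves.SteinWuthrich2013
  Literature.NumberTheory.EllipticCurves.GreenbergVatsal2000
  Literature.NumberTheory.EllipticCurves.EmertonPollackWeston2006
  Literature.NumberTheory.EllipticCurves.BalakrishnanEtAl2019
  Summit.BirchSwinnertonDyer.Rank1Residual.X1.MuLambda
  Summit.BirchSwinnertonDyer.Rank1Residual.X11a.LambdaNorm
  Summit.BirchSwinnertonDyer.Rank1Residual.RankZeroHeightFree

set_option autoImplicit false

namespace Summit.BirchSwinnertonDyer.Rank1Residual.X11a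

open Chain

/-! ### The rank-`0` endpoints of X11a, height-free -/

section Endpoints

variable {W : WeierstrassCurve ℚ} [W.IsElliptic] [W.IsGloballyMinimal] {p : ℕ} [Fact p.Prime]

/-- **X11a: Mazur's main conjecture at `(E,p)` ⇒ `BSD(E,p)`**, height-free twin of
`X11a.bsdp_of_mazurMainConjectureAt` (Stein–Wuthrich Thm. 6.1 `hJs`/`hJn`, Greenberg–Stevens, GZK,
modularity; NO height-existence fact). [cite: SteinWuthrich2013, Thm. 6.1 (p. 20) and §4.2]
[cite: Miller2011LMS, Def. 1.1 and §1] -/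
theorem bsdp_of_mazurMainConjectureAt_heightFree
    (hJs : thm61_splitMultiplicative) (hJn : thm61_nonsplitMultiplicative)
    (hGZK : rank_eq_analyticRank_of_analyticRank_le_one) (hmod : hasEntireLFunction_rat)
    (hpar : nonempty_modularParametrizationData)
    (hGS : greenberg_stevens (W := W) (p := p))
    (hX : ClassX11a W p) (hMC : X2.MazurMainConjectureAt W p) : BSDp W p :=
  X2.bsdp_of_mazurMainConjectureAt_of_analyticRank_eq_zero_heightFree hJs hJn hGZK hmod hpar W p hGS
    hX.ne_two hX.mult hX.1 hMC

end Endpoints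

/-- **The leaf target from its typed missing input**, height-free twin of
`targetLeaf_of_forall_mazurMainConjectureAt`. [cite: SteinWuthrich2013, Thm. 6.1 (p. 20)]
[cite: Miller2011LMS, Def. 1.1 and §1] -/
theorem targetLeaf_of_forall_mazurMainConjectureAt_heightFree
    (hJs : thm61_splitMultiplicative) (hJn : thm61_nonsplitMultiplicative)
    (hGZK : rank_eq_analyticRank_of_analyticRank_le_one) (hmod : hasEntireLFunction_rat)
    (hpar : nonempty_modularParametrizationData)
    (hGS : ∀ (W : WeierstrassCurve ℚ) [W.IsElliptic] [W.IsGloballyMinimal] (p : ℕ) [Fact p.Prime],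
      greenberg_stevens (W := W) (p := p))
    (hMC : ∀ (W : WeierstrassCurve ℚ) [W.IsElliptic] [W.IsGloballyMinimal] (p : ℕ) [Fact p.Prime],
      Leaf W p → X2.MazurMainConjectureAt W p) :
    TargetLeaf :=
  fun W _ _ p _ hL =>
    bsdp_of_mazurMainConjectureAt_heightFree hJs hJn hGZK hmod hpar (hGS W p) hL.1 (hMC W p hL)

/-- **The class statement of record** (published facts + the `p = 3` sub-cell target + the leaf's
typed input), height-free twin of `target_of_published_of_missingInputs`.
[cite: Wuthrich2014, Prop. 21 (p. 400)] [cite: SteinWuthrich2013, Thm. 6.1 (p. 20)]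
[cite: Miller2011LMS, Def. 1.1 and §1] -/
theorem target_of_published_of_missingInputs_heightFree (hWu : sha_dvd_analyticSha)
    (hJs : thm61_splitMultiplicative) (hJn : thm61_nonsplitMultiplicative)
    (hGZK : rank_eq_analyticRank_of_analyticRank_le_one) (hmod : hasEntireLFunction_rat)
    (hpar : nonempty_modularParametrizationData)
    (hGS : ∀ (W : WeierstrassCurve ℚ) [W.IsElliptic] [W.IsGloballyMinimal] (p : ℕ) [Fact p.Prime],
      greenberg_stevens (W := W) (p := p))
    (h3 : TargetThree)
    (hMC : ∀ (W : WeierstrassCurve ℚ) [W.IsElliptic] [W.IsGloballyMinimal] (p : ℕ) [Fact p.Prime],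
      Leaf W p → X2.MazurMainConjectureAt W p) :
    Target :=
  (target_iff_targetThree_and_targetLeaf hWu hGZK hmod).mpr
    ⟨h3, targetLeaf_of_forall_mazurMainConjectureAt_heightFree hJs hJn hGZK hmod hpar hGS hMC⟩

section EPW

variable (W : WeierstrassCurve ℚ) [W.IsElliptic] [W.IsGloballyMinimal] (p : ℕ) [Fact p.Prime]

/-- **`BSD(E,p)` from EPW's invariants at `f_E`** (gen 13 endpoint), height-free twin of
`bsdp_of_invariantsMatchAt`. [cite: EmertonPollackWeston2006, Thm. 5.1.3 and Cor. 5.1.4]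
[cite: SteinWuthrich2013, Thm. 6.1 (p. 20)] [cite: Miller2011LMS, Def. 1.1 and §1] -/
theorem bsdp_of_invariantsMatchAt_heightFree
    (hKato : kato_charIdeal_dvd_multiplicative_of_surjective)
    (hJs : thm61_splitMultiplicative) (hJn : thm61_nonsplitMultiplicative)
    (hGZK : rank_eq_analyticRank_of_analyticRank_le_one) (hmod : hasEntireLFunction_rat)
    (hpar : nonempty_modularParametrizationData)
    (hGS : greenberg_stevens (W := W) (p := p))
    (hp : 5 ≤ p) (hmult : W.HasMultiplicativeReductionAtPrime p)
    (hsurj : W.HasSurjectiveModNGaloisRep p) (hr : W.analyticRank = 0)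
    (hinv : InvariantsMatchAt W p) : BSDp W p :=
  X2.bsdp_of_mazurMainConjectureAt_of_analyticRank_eq_zero_heightFree hJs hJn hGZK hmod hpar W p hGS
    (by omega) hmult hr (mazurMainConjectureAt_of_invariantsMatchAt hKato hmod W p hGS hp hmult hsurj hr hinv)

/-- **`BSD(E,p)` from the certificate `μ^an(E,p) = 0` and the λ-part** (gen 14 endpoint),
height-free twin of `bsdp_of_muAnZeroAt_of_lambdaPart`.
[cite: GreenbergVatsal2000, p. 4 (after Thm. (1.2))] [cite: EmertonPollackWeston2006, Thm. 5.1.2 and Thm. 5.1.3]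
[cite: SteinWuthrich2013, Thm. 6.1 (p. 20)] -/
theorem bsdp_of_muAnZeroAt_of_lambdaPart_heightFree
    (hKato : kato_charIdeal_dvd_multiplicative_of_surjective)
    (hJs : thm61_splitMultiplicative) (hJn : thm61_nonsplitMultiplicative)
    (hGZK : rank_eq_analyticRank_of_analyticRank_le_one) (hmod : hasEntireLFunction_rat)
    (hpar : nonempty_modularParametrizationData)
    (hGS : greenberg_stevens (W := W) (p := p))
    (hp : 5 ≤ p) (hmult : W.HasMultiplicativeReductionAtPrime p)
    (hsurj : W.HasSurjectiveModNGaloisRep p) (hr : W.analyticRank = 0) (hμ : MuAnZeroAt W p)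
    (hlam : LambdaPartAt W p) : BSDp W p :=
  X2.bsdp_of_mazurMainConjectureAt_of_analyticRank_eq_zero_heightFree hJs hJn hGZK hmod hpar W p hGS
    (by omega) hmult hr
    ((mazurMainConjectureAt_iff_lambdaPart_of_muAnZeroAt W p hKato hmod hGS hp hmult hsurj hr hμ).mpr hlam)

/-- **`BSD(E,p)` at a pair of X11a's surjective leaf from the separate published facts** (gen 15
discharge with the existence inputs (E1)–(E3) displayed), height-free twin of `Chain.bsdp_of_facts`.
[cite: EmertonPollackWeston2006, Thm. 1, Thm. 3.1.1, Thm. 5.1.3] [cite: Wan2015, Thm. 4]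
[cite: SteinWuthrich2013, Thm. 6.1 (p. 20)] -/
theorem bsdp_of_facts_heightFree [NeZero (W.conductorNorm ℤ / p)]
    (hHida : hida_exists_congruent_ordinary_newform_of_multiplicative)
    (hMTT : exists_isCycPAdicLFunctionWeightK)
    (h311 : thm311_cotorsion_weightK_member) (hT1a : thm1_muAlg_of_weightK_member)
    (hT2 : Wan2015.thm4_rational_weightK_member) (hT1b : thm513_transfer_from_weightK_member)
    (hKato : kato_charIdeal_dvd_multiplicative_of_surjective)
    (hJs : thm61_splitMultiplicative) (hJn : thm61_nonsplitMultiplicative)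
    (hGZK : rank_eq_analyticRank_of_analyticRank_le_one) (hmod : hasEntireLFunction_rat)
    (hpar : nonempty_modularParametrizationData)
    (hGS : greenberg_stevens (W := W) (p := p))
    (hData : ∀ {k : ℤ} (g : CuspForm (Gamma0 (W.conductorNorm ℤ / p)) k)
      (ι : coeffField g →+* PadicAlgCl p), IsOrdinaryMemberOf W p g ι →
      Nonempty (OrdinaryPadicData g p ι))
    (hDual : ∀ {k : ℤ} (g : CuspForm (Gamma0 (W.conductorNorm ℤ / p)) k)
      (ι : coeffField g →+* PadicAlgCl p), IsOrdinaryMemberOf W p g ι →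
      ∀ (𝔇 : OrdinaryPadicData g p ι) (κ : ZpExtension ℚ p)
      (γ : Field.absoluteGaloisGroup ℚ), κ.IsCyclotomic → κ.IsTopGenerator γ →
      Nonempty (GreenbergSelmer.DualData (padicCoeffField (memberGenerators g ι 𝔇.υ)) κ γ 𝔇.ρ 𝔇.plus))
    (hGen : ∀ {k : ℤ} (g : CuspForm (Gamma0 (W.conductorNorm ℤ / p)) k)
      (ι : coeffField g →+* PadicAlgCl p), IsOrdinaryMemberOf W p g ι →
      ∀ (𝔇 : OrdinaryPadicData g p ι) (κ : ZpExtension ℚ p)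
      (γ : Field.absoluteGaloisGroup ℚ), κ.IsCyclotomic → κ.IsTopGenerator γ →
      ∀ (D : GreenbergSelmer.DualData (padicCoeffField (memberGenerators g ι 𝔇.υ)) κ γ 𝔇.ρ 𝔇.plus),
      Module.Finite (PowerSeries (padicCoeffIntegers (memberGenerators g ι 𝔇.υ))) D.X →
      Module.IsTorsion (PowerSeries (padicCoeffIntegers (memberGenerators g ι 𝔇.υ))) D.X →
      ∃ G, D.charIdeal = Ideal.span {G})
    (hp : 5 ≤ p) (hmult : W.HasMultiplicativeReductionAtPrime p)
    (hsurj : W.HasSurjectiveModNGaloisRep p) (hr : W.analyticRank = 0) (hμ : MuAnZeroAt W p) :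
    BSDp W p :=
  bsdp_of_invariantsMatchAt_heightFree W p hKato hJs hJn hGZK hmod hpar hGS hp hmult hsurj hr
    (invariantsMatchAt_of_invariantsAt_normLam W p
      (invariantsAt_normLam_of_facts W p hHida hMTT h311 hT1a hT2 hT1b hKato hpar hData hDual hGen hp
        hmult hsurj hμ))

end EPW

/-! ### Class level: the chain of record, 14 named facts -/

/-- **X11a ∩ {`p ≥ 5`, `ρ̄_{E,p}` surjective}: `BSD(E,p)` ⇐ NAMED PUBLISHED FACTS (incl. the MTT
existence fact `hMTT`) + the per-pair certificate**, height-free twin of `forall_bsdp_of_namedFacts`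
(the existence inputs (E1)–(E3) being the harvest-2 theorems, as there).
[cite: EmertonPollackWeston2006, Thm. 1, Thm. 3.1.1, Thm. 5.1.3, §3.1] [cite: Wan2015, Thm. 4]
[cite: SteinWuthrich2013, Thm. 6.1 (p. 20)] [cite: Wuthrich2014, Thm. 3 (p. 382) and Cor. 19 proof (p. 399)] -/
theorem forall_bsdp_of_namedFacts_heightFree
    (hHida : hida_exists_congruent_ordinary_newform_of_multiplicative)
    (hMTT : exists_isCycPAdicLFunctionWeightK)
    (h311 : thm311_cotorsion_weightK_member) (hT1a : thm1_muAlg_of_weightK_member)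
    (hT2 : Wan2015.thm4_rational_weightK_member) (hT1b : thm513_transfer_from_weightK_member)
    (h61 : DeligneSerre1974.thm61_exists_adicGaloisRep) (h326 : Hida2000_thm326_ordinary)
    (hKato : kato_charIdeal_dvd_multiplicative_of_surjective)
    (hJs : thm61_splitMultiplicative) (hJn : thm61_nonsplitMultiplicative)
    (hGZK : rank_eq_analyticRank_of_analyticRank_le_one) (hmod : hasEntireLFunction_rat)
    (hpar : nonempty_modularParametrizationData)
    (hGS : ∀ (W : WeierstrassCurve ℚ) [W.IsElliptic] [W.IsGloballyMinimal] (p : ℕ) [Fact p.Prime],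
      greenberg_stevens (W := W) (p := p)) :
    ∀ (W : WeierstrassCurve ℚ) [W.IsElliptic] [W.IsGloballyMinimal] (p : ℕ) [Fact p.Prime],
      ClassX11a W p → 5 ≤ p → Surj W p → MuAnZeroAt W p → BSDp W p := by
  intro W _ _ p _ hX hp hsurj hμ
  haveI : NeZero (W.conductorNorm ℤ / p) := neZero_conductorNorm_div W p hX.2.2.1
  haveI : NeZero p := ⟨(Fact.out : p.Prime).ne_zero⟩
  have hmult : W.HasMultiplicativeReductionAtPrime p := hX.2.2.1
  have hirr : W.HasIrreducibleModPGaloisRep p :=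
    hasIrreducibleModPGaloisRep_of_hasSurjectiveModNGaloisRep W p hsurj
  exact bsdp_of_facts_heightFree W p hHida hMTT h311 hT1a hT2 hT1b hKato hJs hJn hGZK hmod hpar
    (hGS W p)
    (fun g ι hmem =>
      exists_ordinaryPadicData_weightK_member_of_thm61_of_thm326 h61 h326 W p hp hmult hirr g ι hmem)
    (fun g ι hmem 𝔇 κ γ hκ hγ =>
      GreenbergSelmer.exists_dualData_weightK_member_unconditional W p hp hmult hirr g ι hmem 𝔇 κ γ
        hκ hγ)
    (fun g ι hmem 𝔇 κ γ hκ hγ D hfin htors =>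
      (charIdeal_isPrincipal_weightK_member_unconditional W p hp hmult hirr g ι hmem 𝔇 κ γ hκ hγ D
        hfin htors).principal)
    hp hmult hsurj hX.1 hμ

/-- **THE CHAIN OF RECORD — X11a ∩ {`p ≥ 5`, `ρ̄_{E,p}` surjective}: `BSD(E,p)` ⇐ 14 NAMED
PUBLISHED FACTS + the per-pair certificate `μ^an(E,p) = 0`.** The 14: Hida's congruent ordinary
member (`hHida`), EPW 2006 Thm 3.1.1 / Thm 1 / Thm 5.1.3 (`h311`, `hT1a`, `hT1b`), Wan 2015 Thm 4
rational (`hT2`), Deligne–Serre 6.1 (`h61`), Hida/Wiles 3.26 (`h326`), Kato–Wuthrich A32 (`hKato`),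
Stein–Wuthrich 2013 Thm 6.1 split / non-split (`hJs`, `hJn`), Gross–Zagier–Kolyvagin (`hGZK`),
modularity (`hmod`, `hpar`), Greenberg–Stevens (`hGS`).  Versus `forall_bsdp_of_namedFacts_mtt`
(16): the Stein–Wuthrich height-existence facts are discharged (zero datum at rank `0`).  Class-level
residue unchanged: Greenberg's `μ`-conjecture (typed `X11a.MuAnZeroAt`).  No label change.
[cite: MazurTateTeitelbaum1986Invent, §I.11 and §I.14 (14.3)]
[cite: EmertonPollackWeston2006, Thm. 1, Thm. 3.1.1, Thm. 5.1.3, §3.1] [cite: Wan2015, Thm. 4]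
[cite: SteinWuthrich2013, Thm. 6.1 (p. 20) and §4.2] [cite: Wuthrich2014, Thm. 3 (p. 382) and Cor. 19 proof (p. 399)] -/
theorem forall_bsdp_of_namedFacts_mtt_heightFree
    (hHida : hida_exists_congruent_ordinary_newform_of_multiplicative)
    (h311 : thm311_cotorsion_weightK_member) (hT1a : thm1_muAlg_of_weightK_member)
    (hT2 : Wan2015.thm4_rational_weightK_member) (hT1b : thm513_transfer_from_weightK_member)
    (h61 : DeligneSerre1974.thm61_exists_adicGaloisRep) (h326 : Hida2000_thm326_ordinary)
    (hKato : kato_charIdeal_dvd_multiplicative_of_surjective)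
    (hJs : thm61_splitMultiplicative) (hJn : thm61_nonsplitMultiplicative)
    (hGZK : rank_eq_analyticRank_of_analyticRank_le_one) (hmod : hasEntireLFunction_rat)
    (hpar : nonempty_modularParametrizationData)
    (hGS : ∀ (W : WeierstrassCurve ℚ) [W.IsElliptic] [W.IsGloballyMinimal] (p : ℕ) [Fact p.Prime],
      greenberg_stevens (W := W) (p := p)) :
    ∀ (W : WeierstrassCurve ℚ) [W.IsElliptic] [W.IsGloballyMinimal] (p : ℕ) [Fact p.Prime],
      ClassX11a W p → 5 ≤ p → Surj W p → MuAnZeroAt W p → BSDp W p :=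
  forall_bsdp_of_namedFacts_heightFree hHida exists_isCycPAdicLFunctionWeightK_holds h311 hT1a hT2 hT1b
    h61 h326 hKato hJs hJn hGZK hmod hpar hGS

/-- **X11a ∩ {`p ≥ 11`}: `BSD(E,p)` ⇐ 15 NAMED PUBLISHED FACTS + the per-pair certificate, with NO
hypothesis on the image of `ρ̄_{E,p}`** (`Surj` from BDMTV 2019 Thm. 1.2, `hB`, via x11c's
`ClassX11a.surj_of_eleven_le`), height-free twin of `forall_bsdp_of_namedFacts_mtt_of_eleven_le`.
[cite: BalakrishnanEtAl2019, §1 Thm. 1.2 (arXiv:1711.05846 p. 2)]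
[cite: MazurTateTeitelbaum1986Invent, §I.11 and §I.14 (14.3)] [cite: SteinWuthrich2013, Thm. 6.1 (p. 20) and §4.2] -/
theorem forall_bsdp_of_namedFacts_mtt_of_eleven_le_heightFree
    (hHida : hida_exists_congruent_ordinary_newform_of_multiplicative)
    (h311 : thm311_cotorsion_weightK_member) (hT1a : thm1_muAlg_of_weightK_member)
    (hT2 : Wan2015.thm4_rational_weightK_member) (hT1b : thm513_transfer_from_weightK_member)
    (h61 : DeligneSerre1974.thm61_exists_adicGaloisRep) (h326 : Hida2000_thm326_ordinary)
    (hKato : kato_charIdeal_dvd_multiplicative_of_surjective)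
    (hJs : thm61_splitMultiplicative) (hJn : thm61_nonsplitMultiplicative)
    (hGZK : rank_eq_analyticRank_of_analyticRank_le_one) (hmod : hasEntireLFunction_rat)
    (hpar : nonempty_modularParametrizationData)
    (hGS : ∀ (W : WeierstrassCurve ℚ) [W.IsElliptic] [W.IsGloballyMinimal] (p : ℕ) [Fact p.Prime],
      greenberg_stevens (W := W) (p := p))
    (hB : thm12_not_le_normalizer_splitCartan) :
    ∀ (W : WeierstrassCurve ℚ) [W.IsElliptic] [W.IsGloballyMinimal] (p : ℕ) [Fact p.Prime],
      ClassX11a W p → 11 ≤ p → MuAnZeroAt W p → BSDp W p := by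
  intro W _ _ p _ hX h11 hμ
  exact forall_bsdp_of_namedFacts_mtt_heightFree hHida h311 hT1a hT2 hT1b h61 h326 hKato hJs hJn hGZK
    hmod hpar hGS W p hX (by omega) (ClassX11a.surj_of_eleven_le W p hB hX h11) hμ

/-- **X11a ∩ {`p ≥ 5`, `p ∤ ord_p(Δ_min)`}: `BSD(E,p)` ⇐ 14 NAMED PUBLISHED FACTS + the per-pair
certificate, with NO hypothesis on the image of `ρ̄_{E,p}` and no extra named fact** (`Surj` from
the integer check, x11c's `ClassX11a.surj_of_not_dvd`), height-free twin of
`forall_bsdp_of_namedFacts_mtt_of_not_dvd`. [cite: SerreInventiones1972, §1.12 (Cor. of Prop. 13), §2.4 Prop. 15]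
[cite: MazurTateTeitelbaum1986Invent, §I.11 and §I.14 (14.3)] [cite: SteinWuthrich2013, Thm. 6.1 (p. 20) and §4.2] -/
theorem forall_bsdp_of_namedFacts_mtt_of_not_dvd_heightFree
    (hHida : hida_exists_congruent_ordinary_newform_of_multiplicative)
    (h311 : thm311_cotorsion_weightK_member) (hT1a : thm1_muAlg_of_weightK_member)
    (hT2 : Wan2015.thm4_rational_weightK_member) (hT1b : thm513_transfer_from_weightK_member)
    (h61 : DeligneSerre1974.thm61_exists_adicGaloisRep) (h326 : Hida2000_thm326_ordinary)
    (hKato : kato_charIdeal_dvd_multiplicative_of_surjective)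
    (hJs : thm61_splitMultiplicative) (hJn : thm61_nonsplitMultiplicative)
    (hGZK : rank_eq_analyticRank_of_analyticRank_le_one) (hmod : hasEntireLFunction_rat)
    (hpar : nonempty_modularParametrizationData)
    (hGS : ∀ (W : WeierstrassCurve ℚ) [W.IsElliptic] [W.IsGloballyMinimal] (p : ℕ) [Fact p.Prime],
      greenberg_stevens (W := W) (p := p)) :
    ∀ (W : WeierstrassCurve ℚ) [W.IsElliptic] [W.IsGloballyMinimal] (p : ℕ) [Fact p.Prime],
      ClassX11a W p → 5 ≤ p → ¬ p ∣ padicValInt p W.minimalDiscriminantInt →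
        MuAnZeroAt W p → BSDp W p := by
  intro W _ _ p _ hX h5 hn hμ
  exact forall_bsdp_of_namedFacts_mtt_heightFree hHida h311 hT1a hT2 hT1b h61 h326 hKato hJs hJn hGZK
    hmod hpar hGS W p hX h5 (ClassX11a.surj_of_not_dvd W p hX hn) hμ

end Summit.BirchSwinnertonDyer.Rank1Residual.X11a

/-! ### X2a on the cell's predicates, height-free (moved here from `RankZeroHeightFree.lean` for size) -/

namespace Summit.BirchSwinnertonDyer.Rank1Residual.RankZeroHeightFree

/-- The same on the cell's predicates: `r_an = 0 → ClassX2 W p → GVPar W p → BSDp W p`, height-free.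
[cite: GreenbergVatsal2000, Thm. (1.3) with pp. 1, 14–15] [cite: Wuthrich2014, Thm. 16 (p. 397)] -/
theorem _root_.Summit.BirchSwinnertonDyer.Rank1Residual.X2.bsdp_of_classX2_of_gvPar_of_analyticRank_eq_zero_heightFree
    (hGV : lambdaMu_multiplicative_of_gvPar)
    (hWu : thm16_charIdeal_dvd_multiplicative_of_reducible)
    (hJs : thm61_splitMultiplicative) (hJn : thm61_nonsplitMultiplicative)
    (hGZK : rank_eq_analyticRank_of_analyticRank_le_one) (hmod : hasEntireLFunction_rat)
    (hpar : nonempty_modularParametrizationData)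
    (W : WeierstrassCurve ℚ) [W.IsElliptic] [W.IsGloballyMinimal] (p : ℕ) [Fact p.Prime]
    (hGS : greenberg_stevens (W := W) (p := p))
    (hr : W.analyticRank = 0) (hX : ClassX2 W p) (hgv : GVPar W p) : BSDp W p :=
  X2.bsdp_of_mazurMainConjectureAt_of_analyticRank_eq_zero_heightFree hJs hJn hGZK hmod hpar W p hGS
    hX.1 hX.2.2 hr (X2.mazurMainConjectureAt_of_gvPar hGV hWu W p hX.1 hX.2.2 hgv)

end Summit.BirchSwinnertonDyer.Rank1Residual.RankZeroHeightFree

end
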